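import Summits.Parity.GeneralizedHardyLittlewood.Theorems.PrimeLevelFamEdgeMomentsBeyondDiagonalDiagBoseSymm
import Summits.Parity.GeneralizedHardyLittlewood.Theorems.PrimeLevelFamEdgeMomentsBeyondDiagonalDiagBoseKernel2
import HarnessLib

/-!
# Route `PrimeLevelFamEdge`, crux K_A `MomentsBeyondDiagonal` (stmt-Parity-20007), line «petersson_layers» v4, stub `stub_diag`:
# **census R2, mixed Bose coefficients — REDUCTION TO THE UNIT-BOX MODEL INTEGRAL**

The two-dimensional Bose coefficient of `…DiagBoseOuter.bose_expand` (p812352),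
`c_ab(y) = ∫_{u₁>0}(log u₁)^a∫_{u₂>y/u₁} B(u₁+u₂)(log u₂)^b`, `B(φ) = e^{−φ}(1−e^{−φ})^{−2}`, differs from the MODEL INTEGRAL
`M_ab(y) = ∫∫_{0<u₁,u₂≤1, u₁u₂>y}(log u₁)^a(log u₂)^b(u₁+u₂)^{−2}` by `O_{a,b}(1)` uniformly in `y > 0`:
on the unit box `|B(φ) − 1/φ²| ≤ 1` (`…DiagBoseKernel2.abs_bose_kernel_sub_inv_sq_le`, p818238) and `∫₀¹|log|^a∫₀¹|log|^b < ∞`;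
off the box `φ = u₁+u₂ > 1`, where `B(φ) ≤ (1−e^{−1})^{−2}e^{−u₁}e^{−u₂}` and `∫₀^∞ e^{−u}|log u|^n < ∞`.

* `bose_coeff_sub_box_le` — **`|c_ab(y) − M_ab(y)| ≤ C_{a,b}` for all `y > 0`**, with `M_ab` written as the iterated
  integral over `(0,∞)²` of the guarded integrand (the form consumed by `…DiagBoseMixedRatio.box_eq_ratio_integral`).

Def-free; theorems only. Helper `--supports stmt-Parity-20007`; closes nothing; K_A, K_B and the Parity summit are NOT
proved; nothing about Landau–Siegel zeros.

## References
* E. Kowalski, P. Michel, J. VanderKam, J. reine angew. Math. 526 (2000), (22)–(28) pp. 12–15.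
  [cite: KowalskiMichelVanderKam2000, (22)–(28) — derivation (residues of the diagonal weight, real-variable form)]
-/

noncomputable section

open Real Set MeasureTheory Filter Function Finset

namespace Summit.Parity.GeneralizedHardyLittlewood.Theorems.MomentsBeyondDiagonal.DiagLines

/-- Off the unit box the Bose kernel is exponentially small: for `u₁, u₂ > 0` with `¬(u₁ ≤ 1 ∧ u₂ ≤ 1)`,
`B(u₁+u₂) ≤ (1−e^{−1})^{−2} e^{−u₁} e^{−u₂}`. [folklore] -/
theorem bose_kernel_le_off_box {u₁ u₂ : ℝ} (hu₁ : 0 < u₁) (hu₂ : 0 < u₂) (h : ¬ (u₁ ≤ 1 ∧ u₂ ≤ 1)) :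
    Real.exp (-(u₁ + u₂)) / (1 - Real.exp (-(u₁ + u₂))) ^ 2 ≤
      ((1 - Real.exp (-1)) ^ 2)⁻¹ * (Real.exp (-u₁) * Real.exp (-u₂)) := by
  have hφ : 1 ≤ u₁ + u₂ := by
    by_contra hlt
    rw [not_le] at hlt
    exact h ⟨by linarith, by linarith⟩
  have he1 : Real.exp (-(u₁ + u₂)) ≤ Real.exp (-1) := Real.exp_le_exp.2 (by linarith)
  have he1' : Real.exp (-1) < 1 := by
    have h' : Real.exp (-1) < Real.exp 0 := Real.exp_lt_exp.2 (by norm_num)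
    rwa [Real.exp_zero] at h'
  have hd0 : 0 < 1 - Real.exp (-1) := by linarith
  have hd : (1 - Real.exp (-1)) ^ 2 ≤ (1 - Real.exp (-(u₁ + u₂))) ^ 2 := by
    apply pow_le_pow_left₀ hd0.le; linarith
  calc Real.exp (-(u₁ + u₂)) / (1 - Real.exp (-(u₁ + u₂))) ^ 2
      = Real.exp (-(u₁ + u₂)) * ((1 - Real.exp (-(u₁ + u₂))) ^ 2)⁻¹ := div_eq_mul_inv _ _
    _ ≤ Real.exp (-(u₁ + u₂)) * ((1 - Real.exp (-1)) ^ 2)⁻¹ :=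
        mul_le_mul_of_nonneg_left (inv_anti₀ (by positivity) hd) (Real.exp_pos _).le
    _ = ((1 - Real.exp (-1)) ^ 2)⁻¹ * (Real.exp (-u₁) * Real.exp (-u₂)) := by
        rw [neg_add, Real.exp_add]; ring

/-- **REDUCTION OF THE MIXED BOSE COEFFICIENT TO THE UNIT-BOX MODEL INTEGRAL.** For all `a, b` there is `C` such that
for every `y > 0`:
`|∫_{u₁>0}(log u₁)^a∫_{u₂>y/u₁}B(u₁+u₂)(log u₂)^b − ∫_{u₁>0}∫_{u₂>0}1[y<u₁u₂, u₁≤1, u₂≤1](log u₁)^a(log u₂)^b(u₁+u₂)^{−2}| ≤ C`.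
[cite: KowalskiMichelVanderKam2000, (22)–(28) — derivation (real-variable model of the residues of the diagonal weight)] -/
theorem bose_coeff_sub_box_le (a b : ℕ) : ∃ C : ℝ, ∀ y : ℝ, 0 < y →
    |(∫ u₁ in Ioi (0 : ℝ), Real.log u₁ ^ a *
        ∫ u₂ in Ioi (y / u₁), Real.exp (-(u₁ + u₂)) / (1 - Real.exp (-(u₁ + u₂))) ^ 2 * Real.log u₂ ^ b) -
      ∫ u₁ in Ioi (0 : ℝ), ∫ u₂ in Ioi (0 : ℝ), (if 0 < u₁ ∧ 0 < u₂ ∧ y < u₁ * u₂ ∧ u₁ ≤ 1 ∧ u₂ ≤ 1 then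
        Real.log u₁ ^ a * Real.log u₂ ^ b / (u₁ + u₂) ^ 2 else 0)| ≤ C := by
  -- universal constants: `e·∫₀^∞ e^{−u}|log u|^n` dominates `∫₀¹|log|^n`; `E_n = ∫₀^∞ e^{−u}|log u|^n`
  set Fa : ℝ → ℝ := fun u ↦ Real.exp 1 * (Real.exp (-u) * |(0 : ℝ) + Real.log u| ^ a) with hFa
  set Fb : ℝ → ℝ := fun u ↦ Real.exp 1 * (Real.exp (-u) * |(0 : ℝ) + Real.log u| ^ b) with hFb
  set Ce : ℝ := ((1 - Real.exp (-1)) ^ 2)⁻¹ with hCe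
  set Ea : ℝ → ℝ := fun u ↦ Ce * (Real.exp (-u) * |(0 : ℝ) + Real.log u| ^ a) with hEa
  set Eb : ℝ → ℝ := fun u ↦ Real.exp (-u) * |(0 : ℝ) + Real.log u| ^ b with hEb
  have hFa_int : Integrable Fa (volume.restrict (Ioi (0 : ℝ))) := (integrableOn_exp_neg_mul_abs_logPow 0 a).const_mul _
  have hFb_int : Integrable Fb (volume.restrict (Ioi (0 : ℝ))) := (integrableOn_exp_neg_mul_abs_logPow 0 b).const_mul _
  have hEa_int : Integrable Ea (volume.restrict (Ioi (0 : ℝ))) := (integrableOn_exp_neg_mul_abs_logPow 0 a).const_mul _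
  have hEb_int : Integrable Eb (volume.restrict (Ioi (0 : ℝ))) := integrableOn_exp_neg_mul_abs_logPow 0 b
  refine ⟨(∫ u in Ioi (0 : ℝ), Fa u) * (∫ u in Ioi (0 : ℝ), Fb u) + (∫ u in Ioi (0 : ℝ), Ea u) * (∫ u in Ioi (0 : ℝ), Eb u),
    fun y hy ↦ ?_⟩
  set μ₂ : Measure (ℝ × ℝ) := (volume.restrict (Ioi (0 : ℝ))).prod (volume.restrict (Ioi (0 : ℝ))) with hμ₂
  -- the four guarded integrands
  set G : ℝ × ℝ → ℝ := fun p ↦ if 0 < p.1 ∧ 0 < p.2 ∧ y < p.1 * p.2 then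
      Real.exp (-(p.1 + p.2)) / (1 - Real.exp (-(p.1 + p.2))) ^ 2 * Real.log p.1 ^ a * Real.log p.2 ^ b else 0 with hG
  set m : ℝ × ℝ → ℝ := fun p ↦ if 0 < p.1 ∧ 0 < p.2 ∧ y < p.1 * p.2 ∧ p.1 ≤ 1 ∧ p.2 ≤ 1 then
      Real.log p.1 ^ a * Real.log p.2 ^ b / (p.1 + p.2) ^ 2 else 0 with hm
  set e₁ : ℝ × ℝ → ℝ := fun p ↦ if 0 < p.1 ∧ 0 < p.2 ∧ y < p.1 * p.2 ∧ p.1 ≤ 1 ∧ p.2 ≤ 1 then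
      (Real.exp (-(p.1 + p.2)) / (1 - Real.exp (-(p.1 + p.2))) ^ 2 - 1 / (p.1 + p.2) ^ 2) *
        Real.log p.1 ^ a * Real.log p.2 ^ b else 0 with he₁
  set e₂ : ℝ × ℝ → ℝ := fun p ↦ if 0 < p.1 ∧ 0 < p.2 ∧ y < p.1 * p.2 ∧ ¬ (p.1 ≤ 1 ∧ p.2 ≤ 1) then
      Real.exp (-(p.1 + p.2)) / (1 - Real.exp (-(p.1 + p.2))) ^ 2 * Real.log p.1 ^ a * Real.log p.2 ^ b else 0 with he₂
  have hsplit : ∀ p, G p = m p + e₁ p + e₂ p := by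
    intro p
    simp only [hG, hm, he₁, he₂]
    by_cases h0 : 0 < p.1 ∧ 0 < p.2 ∧ y < p.1 * p.2
    · rw [if_pos h0]
      by_cases hb : p.1 ≤ 1 ∧ p.2 ≤ 1
      · rw [if_pos ⟨h0.1, h0.2.1, h0.2.2, hb⟩, if_pos ⟨h0.1, h0.2.1, h0.2.2, hb⟩, if_neg (fun h ↦ h.2.2.2 hb)]
        have hφ : (p.1 + p.2) ^ 2 ≠ 0 := by nlinarith [h0.1, h0.2.1]
        field_simp
        ring
      · rw [if_neg (fun h ↦ hb h.2.2.2), if_neg (fun h ↦ hb h.2.2.2), if_pos ⟨h0.1, h0.2.1, h0.2.2, hb⟩]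
        ring
    · rw [if_neg h0, if_neg (fun h ↦ h0 ⟨h.1, h.2.1, h.2.2.1⟩), if_neg (fun h ↦ h0 ⟨h.1, h.2.1, h.2.2.1⟩),
        if_neg (fun h ↦ h0 ⟨h.1, h.2.1, h.2.2.1⟩)]
      ring
  -- measurability
  have hS0 : MeasurableSet {p : ℝ × ℝ | 0 < p.1 ∧ 0 < p.2 ∧ y < p.1 * p.2 ∧ p.1 ≤ 1 ∧ p.2 ≤ 1} :=
    (measurableSet_lt measurable_const measurable_fst).inter
      ((measurableSet_lt measurable_const measurable_snd).inter
        ((measurableSet_lt measurable_const (measurable_fst.mul measurable_snd)).inter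
          ((measurableSet_le measurable_fst measurable_const).inter (measurableSet_le measurable_snd measurable_const))))
  have hS2 : MeasurableSet {p : ℝ × ℝ | 0 < p.1 ∧ 0 < p.2 ∧ y < p.1 * p.2 ∧ ¬ (p.1 ≤ 1 ∧ p.2 ≤ 1)} :=
    (measurableSet_lt measurable_const measurable_fst).inter
      ((measurableSet_lt measurable_const measurable_snd).inter
        ((measurableSet_lt measurable_const (measurable_fst.mul measurable_snd)).inter
          ((measurableSet_le measurable_fst measurable_const).inter (measurableSet_le measurable_snd measurable_const)).compl))
  have hBmeas : Measurable fun p : ℝ × ℝ ↦ Real.exp (-(p.1 + p.2)) / (1 - Real.exp (-(p.1 + p.2))) ^ 2 :=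
    (Real.measurable_exp.comp (measurable_fst.add measurable_snd).neg).div
      ((measurable_const.sub (Real.measurable_exp.comp (measurable_fst.add measurable_snd).neg)).pow_const 2)
  have hLa : Measurable fun p : ℝ × ℝ ↦ Real.log p.1 ^ a := (Real.measurable_log.comp measurable_fst).pow_const a
  have hLb : Measurable fun p : ℝ × ℝ ↦ Real.log p.2 ^ b := (Real.measurable_log.comp measurable_snd).pow_const b
  have he₁_meas : Measurable e₁ := by
    refine Measurable.ite hS0 (((hBmeas.sub ?_).mul hLa).mul hLb) measurable_const
    exact measurable_const.div ((measurable_fst.add measurable_snd).pow_const 2)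
  have he₂_meas : Measurable e₂ := Measurable.ite hS2 ((hBmeas.mul hLa).mul hLb) measurable_const
  -- integrability
  have hG_int : Integrable G μ₂ := integrable_boseGuard hy a b
  have hdom₁ : Integrable (fun p : ℝ × ℝ ↦ Fa p.1 * Fb p.2) μ₂ := hFa_int.mul_prod hFb_int
  have hdom₂ : Integrable (fun p : ℝ × ℝ ↦ Ea p.1 * Eb p.2) μ₂ := hEa_int.mul_prod hEb_int
  have hlog_le : ∀ u : ℝ, 0 < u → u ≤ 1 → ∀ n : ℕ,
      |Real.log u| ^ n ≤ Real.exp 1 * (Real.exp (-u) * |(0 : ℝ) + Real.log u| ^ n) := by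
    intro u hu hu1 n
    have he : 1 ≤ Real.exp 1 * Real.exp (-u) := by
      rw [← Real.exp_add]; exact Real.one_le_exp (by linarith)
    rw [zero_add]
    calc |Real.log u| ^ n = 1 * |Real.log u| ^ n := (one_mul _).symm
      _ ≤ (Real.exp 1 * Real.exp (-u)) * |Real.log u| ^ n := by gcongr
      _ = _ := by ring
  have he₁_bd : ∀ p, ‖e₁ p‖ ≤ Fa p.1 * Fb p.2 := by
    intro p
    simp only [he₁, hFa, hFb]
    by_cases h : 0 < p.1 ∧ 0 < p.2 ∧ y < p.1 * p.2 ∧ p.1 ≤ 1 ∧ p.2 ≤ 1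
    · rw [if_pos h]
      obtain ⟨h1, h2, -, h11, h21⟩ := h
      have hK := abs_bose_kernel_sub_inv_sq_le (by linarith : 0 < p.1 + p.2)
      rw [Real.norm_eq_abs, abs_mul, abs_mul, abs_pow, abs_pow]
      calc |Real.exp (-(p.1 + p.2)) / (1 - Real.exp (-(p.1 + p.2))) ^ 2 - 1 / (p.1 + p.2) ^ 2| *
            |Real.log p.1| ^ a * |Real.log p.2| ^ b
          ≤ 1 * (Real.exp 1 * (Real.exp (-p.1) * |(0 : ℝ) + Real.log p.1| ^ a)) *
              (Real.exp 1 * (Real.exp (-p.2) * |(0 : ℝ) + Real.log p.2| ^ b)) := by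
            gcongr
            · exact hlog_le p.1 h1 h11 a
            · exact hlog_le p.2 h2 h21 b
        _ = _ := by ring
    · rw [if_neg h, norm_zero]
      positivity
  have he₂_bd : ∀ p, ‖e₂ p‖ ≤ Ea p.1 * Eb p.2 := by
    intro p
    simp only [he₂, hEa, hEb]
    by_cases h : 0 < p.1 ∧ 0 < p.2 ∧ y < p.1 * p.2 ∧ ¬ (p.1 ≤ 1 ∧ p.2 ≤ 1)
    · rw [if_pos h]
      obtain ⟨h1, h2, -, hnb⟩ := h
      have hK := bose_kernel_le_off_box h1 h2 hnb
      have hK0 : 0 ≤ Real.exp (-(p.1 + p.2)) / (1 - Real.exp (-(p.1 + p.2))) ^ 2 := by positivity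
      rw [Real.norm_eq_abs, abs_mul, abs_mul, abs_of_nonneg hK0, abs_pow, abs_pow, zero_add, zero_add]
      calc Real.exp (-(p.1 + p.2)) / (1 - Real.exp (-(p.1 + p.2))) ^ 2 * |Real.log p.1| ^ a * |Real.log p.2| ^ b
          ≤ (Ce * (Real.exp (-p.1) * Real.exp (-p.2))) * |Real.log p.1| ^ a * |Real.log p.2| ^ b := by gcongr
        _ = Ce * (Real.exp (-p.1) * |Real.log p.1| ^ a) * (Real.exp (-p.2) * |Real.log p.2| ^ b) := by ring
    · rw [if_neg h, norm_zero]
      positivity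
  have he₁_int : Integrable e₁ μ₂ := Integrable.mono' hdom₁ he₁_meas.aestronglyMeasurable (ae_of_all _ he₁_bd)
  have he₂_int : Integrable e₂ μ₂ := Integrable.mono' hdom₂ he₂_meas.aestronglyMeasurable (ae_of_all _ he₂_bd)
  have hm_int : Integrable m μ₂ := by
    refine ((hG_int.sub he₁_int).sub he₂_int).congr (ae_of_all _ fun p ↦ ?_)
    simp only [Pi.sub_apply]
    rw [hsplit p]
    ring
  -- the coefficient and the model as integrals over the product measure
  have hL : ∫ u₁ in Ioi (0 : ℝ), ∫ u₂ in Ioi (0 : ℝ), G (u₁, u₂) =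
      ∫ u₁ in Ioi (0 : ℝ), Real.log u₁ ^ a *
        ∫ u₂ in Ioi (y / u₁), Real.exp (-(u₁ + u₂)) / (1 - Real.exp (-(u₁ + u₂))) ^ 2 * Real.log u₂ ^ b := by
    refine setIntegral_congr_fun measurableSet_Ioi fun u₁ hu₁ ↦ ?_
    simp only [hG]
    exact integral_boseGuard_snd hy hu₁ a b
  have h12 : ∫ p, G p ∂μ₂ = ∫ u₁ in Ioi (0 : ℝ), ∫ u₂ in Ioi (0 : ℝ), G (u₁, u₂) := integral_prod G hG_int
  have hm12 : ∫ p, m p ∂μ₂ = ∫ u₁ in Ioi (0 : ℝ), ∫ u₂ in Ioi (0 : ℝ), m (u₁, u₂) := integral_prod m hm_int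
  have hGsum : ∫ p, G p ∂μ₂ = ∫ p, m p ∂μ₂ + ∫ p, e₁ p ∂μ₂ + ∫ p, e₂ p ∂μ₂ := by
    have h1 : ∫ p, G p ∂μ₂ = ∫ p, (m p + e₁ p) + e₂ p ∂μ₂ := integral_congr_ae (ae_of_all _ fun p ↦ hsplit p)
    have h2 : Integrable (fun p ↦ m p + e₁ p) μ₂ := hm_int.add he₁_int
    rw [h1, integral_add h2 he₂_int, integral_add hm_int he₁_int]
  have hE₁ : ‖∫ p, e₁ p ∂μ₂‖ ≤ (∫ u in Ioi (0 : ℝ), Fa u) * ∫ u in Ioi (0 : ℝ), Fb u :=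
    (norm_integral_le_of_norm_le hdom₁ (ae_of_all _ he₁_bd)).trans_eq (integral_prod_mul Fa Fb)
  have hE₂ : ‖∫ p, e₂ p ∂μ₂‖ ≤ (∫ u in Ioi (0 : ℝ), Ea u) * ∫ u in Ioi (0 : ℝ), Eb u :=
    (norm_integral_le_of_norm_le hdom₂ (ae_of_all _ he₂_bd)).trans_eq (integral_prod_mul Ea Eb)
  have hcM : (∫ u₁ in Ioi (0 : ℝ), Real.log u₁ ^ a *
        ∫ u₂ in Ioi (y / u₁), Real.exp (-(u₁ + u₂)) / (1 - Real.exp (-(u₁ + u₂))) ^ 2 * Real.log u₂ ^ b) -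
      (∫ u₁ in Ioi (0 : ℝ), ∫ u₂ in Ioi (0 : ℝ), m (u₁, u₂)) = ∫ p, e₁ p ∂μ₂ + ∫ p, e₂ p ∂μ₂ := by
    rw [← hL, ← h12, ← hm12, hGsum]; ring
  have hgoal : (∫ u₁ in Ioi (0 : ℝ), ∫ u₂ in Ioi (0 : ℝ), (if 0 < u₁ ∧ 0 < u₂ ∧ y < u₁ * u₂ ∧ u₁ ≤ 1 ∧ u₂ ≤ 1 then
        Real.log u₁ ^ a * Real.log u₂ ^ b / (u₁ + u₂) ^ 2 else 0)) =
      ∫ u₁ in Ioi (0 : ℝ), ∫ u₂ in Ioi (0 : ℝ), m (u₁, u₂) := by simp only [hm]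
  rw [hgoal, hcM]
  calc |∫ p, e₁ p ∂μ₂ + ∫ p, e₂ p ∂μ₂| ≤ |∫ p, e₁ p ∂μ₂| + |∫ p, e₂ p ∂μ₂| := abs_add_le _ _
    _ ≤ _ := by
        rw [← Real.norm_eq_abs, ← Real.norm_eq_abs]
        exact add_le_add hE₁ hE₂

end Summit.Parity.GeneralizedHardyLittlewood.Theorems.MomentsBeyondDiagonal.DiagLines

end
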